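import Literature.AlgebraicGeometry.Resolution.BlowupSequencesSNC
import Literature.AlgebraicGeometry.Resolution.BlowupRestrictOpen
import Literature.AlgebraicGeometry.Resolution.EffectiveCartierStalks
import Literature.AlgebraicGeometry.Resolution.SubschemeRegularStalks
import Literature.AlgebraicGeometry.Resolution.PointCentrePermissible
import Literature.AlgebraicGeometry.Resolution.KollarTripleMaxOrd
import HarnessLib

/-!
# Blowing up a closed point of a marked ideal on a regular one-dimensional germ (every characteristic)

Topic: `Literature/AlgebraicGeometry/Resolution`. The single step of order reduction for marked
ideals in dimension ONE (J. Kollár, *Lectures on Resolution of Singularities* (2007), Thm. 3.69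
with 3.70 and 3.111 Step 1; E. Bierstone, D. Grigoriev, P. Milman, J. Włodarczyk,
arXiv:1206.3090, Def. 3.1.3, §3.2): the blowing up of a closed point `x` of the support
`supp(𝓘, μ)` of a marked ideal `(X, 𝓘, E, μ)` at which `𝔪_x = (u)` is principal and `𝓘_x ≠ 0`.
The reduced point is an admissible centre for every simple normal crossing boundary, a regular
scheme, and an effective Cartier divisor, so its blowing up `π` is an ISOMORPHISM (Görtz–Wedhorn I,
remark after Def. 13.90; tree `IsBlowup.isIso`) under which the controlled transform
`σᶜ(𝓘, μ) = (π^*𝓘 : 𝓘(D)^μ)` has stalk `(𝓘_x : 𝔪_x^μ)` over `x` — of order `≤ ord_x 𝓘 − μ` — and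
the stalks of `𝓘` elsewhere. No derivative and no hypothesis on the characteristic enter.

* `HasSNC.hasSNCWith_vanishingIdeal_singleton`, `isEffectiveCartier_vanishingIdeal_singleton`,
  `isIso_blowupπ_vanishingIdeal_singleton` — a closed (reduced) point as a centre (regularity of
  the point: `isRegular_subscheme_vanishingIdeal_singleton`, `PointCentrePermissible.lean`);
* `not_colon_le_pow_of_maximalIdeal_eq_span` — in a local domain with `𝔪 = (u)`:
  `(J : 𝔪^μ) ∋ u^{a-μ} w ∉ 𝔪^{a-μ+1}` for `f = u^a w ∈ J` of order `a ≥ μ`;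
* `isAdmissibleFor_cons_vanishingIdeal_singleton_iff`, `support_transform_point_subset`,
  `idealOrder_transform_point_le`, `stalkIdeal_transform_point_ne_bot`,
  `maximalIdeal_eq_span_of_point`, `isClosed_singleton_of_point` — the transform of the marked
  ideal along the point blow-up: admissibility, `supp M' ⊆ π⁻¹ supp M`, orders do not go up, the
  hypotheses (closed points, principal maximal ideals, non-zero stalks) reproduce themselves;
* **`idealOrder_transform_point_lt`** — over `x` the order DROPS: `ord_{x'} σᶜ(𝓘, μ) < ord_x 𝓘`.

The terminating induction (order reduction in dimension one) is `MarkedCurveOrderReduction.lean`.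

## Sources

* J. Kollár, *Lectures on Resolution of Singularities* (2007): Thm. 3.69, 3.70, 3.111 Step 1. [Kollar2007]
* E. Bierstone, D. Grigoriev, P. Milman, J. Włodarczyk, arXiv:1206.3090: Def. 3.1.3, §3.2,
  Lemma 3.2.1. [BierstoneGrigorievMilmanWlodarczyk2011]
* U. Görtz, T. Wedhorn, *Algebraic Geometry I* (2020), (13.19): remark after Def. 13.90. [GortzWedhorn2020]
-/

noncomputable section

open CategoryTheory CategoryTheory.Limits AlgebraicGeometry TopologicalSpace IsLocalRing
  Scheme.IdealSheafData

namespace Literature.AlgebraicGeometry.Resolution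

universe u

variable {X : Scheme.{u}}


/-! ## Closed points as centres -/

section PointCentre

/-- The support of the ideal sheaf of a closed (reduced) point is the point (reduced induced
closed subscheme structure on `{x}`). [cite: StacksProject, Tag 01J4] -/
theorem coe_support_vanishingIdeal_singleton {x : X} (hx : IsClosed ({x} : Set X)) :
    ((vanishingIdeal ⟨{x}, hx⟩).support : Set X) = {x} :=
  coe_support_vanishingIdeal _

/-- Membership in the support of the ideal sheaf of a closed point. [cite: StacksProject, Tag 01J4] -/
theorem mem_support_vanishingIdeal_singleton_iff {x : X} (hx : IsClosed ({x} : Set X)) {y : X} :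
    y ∈ (vanishingIdeal ⟨{x}, hx⟩).support ↔ y = x := by
  rw [← SetLike.mem_coe, coe_support_vanishingIdeal_singleton hx, Set.mem_singleton_iff]

/-- **A closed point is an admissible centre for every simple normal crossing boundary**: its
stalk ideal `𝔪_x` is generated by the whole regular system of parameters (BGMW Def. 3.1.3 (2)
with `C = {x}`). [cite: BierstoneGrigorievMilmanWlodarczyk2011, Def. 3.1.3 (2)] -/
theorem HasSNC.hasSNCWith_vanishingIdeal_singleton {E : List X.IdealSheafData} (hE : HasSNC E)
    {x : X} (hx : IsClosed ({x} : Set X)) : HasSNCWith E (vanishingIdeal ⟨{x}, hx⟩) := by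
  intro y
  obtain ⟨hreg, u, hu, hι, -⟩ := hE y
  refine ⟨hreg, u, hu, hι, fun hy => ⟨Set.univ, ?_⟩⟩
  obtain rfl := (mem_support_vanishingIdeal_singleton_iff hx).mp hy
  rw [Set.image_univ, hu, stalkIdeal_vanishingIdeal_singleton hx]

/-- **A closed point `x` with `𝔪_x = (u)`, `u ≠ 0` in the domain `𝒪_{X,x}`, is an effective
Cartier divisor** (Stacks 01WS, locally Noetherian form: the stalk of its ideal at the only point
of its support is generated by a non-zero-divisor). [cite: StacksProject, Tag 01WS] -/
theorem isEffectiveCartier_vanishingIdeal_singleton [IsLocallyNoetherian X] {x : X}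
    (hx : IsClosed ({x} : Set X)) [IsDomain (X.presheaf.stalk x)] {u : X.presheaf.stalk x}
    (hu : maximalIdeal (X.presheaf.stalk x) = Ideal.span {u}) (hu0 : u ≠ 0) :
    IsEffectiveCartier (vanishingIdeal ⟨{x}, hx⟩) := by
  refine isEffectiveCartier_of_forall_mem_nonZeroDivisors fun y hy => ?_
  obtain rfl := (mem_support_vanishingIdeal_singleton_iff hx).mp hy
  exact ⟨u, mem_nonZeroDivisors_of_ne_zero hu0, by rw [stalkIdeal_vanishingIdeal_singleton hx, hu]⟩

/-- Hence **the blowing up of such a point is an isomorphism** (Görtz–Wedhorn I, remark after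
Def. 13.90: blowing up an effective Cartier divisor). [cite: GortzWedhorn2020, (13.19) p. 413] -/
theorem isIso_blowupπ_vanishingIdeal_singleton [IsLocallyNoetherian X] {x : X}
    (hx : IsClosed ({x} : Set X)) [IsDomain (X.presheaf.stalk x)] {u : X.presheaf.stalk x}
    (hu : maximalIdeal (X.presheaf.stalk x) = Ideal.span {u}) (hu0 : u ≠ 0) :
    IsIso (blowup.π (vanishingIdeal ⟨{x}, hx⟩)) :=
  (blowup.isBlowup _).isIso (isEffectiveCartier_vanishingIdeal_singleton hx hu hu0)

end PointCentre

/-! ## The controlled transform along an isomorphic blowing up of a point -/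

section Transform

variable {X' : Scheme.{u}} (π : X' ⟶ X)

/-- Along a morphism with bijective stalk map at `x'`, `ord_{x'}(π^*𝓘) = ord_{π x'}(𝓘)`.
[cite: BierstoneGrigorievMilmanWlodarczyk2011, Lemma 8.0.3 (2)] -/
private theorem idealOrder_comap_of_isIso_stalkMap' (I : X.IdealSheafData) (x' : X')
    [IsIso (π.stalkMap x')] :
    idealOrder (I.comap π) x' = idealOrder I (π x') :=
  ENat.eq_of_forall_natCast_le_iff fun n => by
    rw [le_idealOrder_iff, le_idealOrder_iff,
      stalkIdeal_comap_le_maximalIdeal_pow_iff_of_isIso_stalkMap π I x' n]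

/-- The controlled transform contains the total transform, so its order is at most the order of
the total transform: `ord_{x'} σᶜ(𝓘, μ) ≤ ord_{x'} σ^*𝓘`. [cite: BierstoneGrigorievMilmanWlodarczyk2011, §3.2] -/
theorem idealOrder_controlledTransform_le (C I : X.IdealSheafData) (μ : ℕ) (x' : X') :
    idealOrder (controlledTransform π C I μ) x' ≤ idealOrder (I.comap π) x' := by
  refine ENat.forall_natCast_le_iff_le.mp fun n hn => ?_
  rw [le_idealOrder_iff] at hn ⊢
  exact (stalkIdeal_mono (comap_le_controlledTransform π C I μ) x').trans hn

/-- Hence, at a point with bijective stalk map, `ord_{x'} σᶜ(𝓘, μ) ≤ ord_{π x'} 𝓘`.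
[cite: BierstoneGrigorievMilmanWlodarczyk2011, §3.2] -/
theorem idealOrder_controlledTransform_le_of_isIso_stalkMap (C I : X.IdealSheafData) (μ : ℕ)
    (x' : X') [IsIso (π.stalkMap x')] :
    idealOrder (controlledTransform π C I μ) x' ≤ idealOrder I (π x') :=
  (idealOrder_controlledTransform_le π C I μ x').trans (idealOrder_comap_of_isIso_stalkMap' π I x').le

/-- The stalk of the controlled transform is nonzero where the stalk of `𝓘` at the image point is
nonzero (bijective stalk map): it contains the total transform.
[cite: BierstoneGrigorievMilmanWlodarczyk2011, §3.2] -/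
theorem stalkIdeal_controlledTransform_ne_bot_of_isIso_stalkMap (C I : X.IdealSheafData) (μ : ℕ)
    (x' : X') [IsIso (π.stalkMap x')] (h : stalkIdeal I (π x') ≠ ⊥) :
    stalkIdeal (controlledTransform π C I μ) x' ≠ ⊥ := by
  intro hbot
  have hle := stalkIdeal_mono (comap_le_controlledTransform π C I μ) x'
  rw [hbot, le_bot_iff, stalkIdeal_comap_eq_map] at hle
  apply h
  have hinj : Function.Injective (π.stalkMap x').hom :=
    (ConcreteCategory.bijective_of_isIso (π.stalkMap x')).1
  exact (Ideal.map_eq_bot_iff_of_injective hinj).mp hle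

/-- In a local ring with principal maximal ideal `𝔪 = (u)`, an element of `𝔪^a ∖ 𝔪^{a+1}` is
`u^a` times a unit (the shape of elements of a discrete valuation ring, Matsumura Thm. 11.2, used
here only through `𝔪 = (u)`). [cite: Matsumura1987, Thm. 11.2] -/
theorem exists_eq_pow_mul_unit_of_maximalIdeal_eq_span {R : Type*} [CommRing R] [IsLocalRing R]
    {u : R} (hu : maximalIdeal R = Ideal.span {u}) {a : ℕ} {f : R}
    (hfa : f ∈ maximalIdeal R ^ a) (hfa1 : f ∉ maximalIdeal R ^ (a + 1)) :
    ∃ w : R, IsUnit w ∧ f = u ^ a * w := by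
  rw [hu, Ideal.span_singleton_pow, Ideal.mem_span_singleton] at hfa
  obtain ⟨w, rfl⟩ := hfa
  refine ⟨w, ?_, rfl⟩
  by_contra hw
  apply hfa1
  have hwm : w ∈ Ideal.span {u} := hu ▸ (mem_maximalIdeal _).mpr hw
  obtain ⟨w', rfl⟩ := Ideal.mem_span_singleton.mp hwm
  rw [hu, Ideal.span_singleton_pow, Ideal.mem_span_singleton]
  exact ⟨w', by ring⟩

/-- **The colon ideal `(𝓘_x : 𝔪_x^μ)` has order `≤ ord_x 𝓘 − μ`** in a local domain with
principal maximal ideal: if `f = u^a w ∈ 𝓘_x` (`w` a unit, `μ ≤ a`) then `u^{a-μ} w ∈ (𝓘_x : 𝔪_x^μ)`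
and `u^{a-μ} w ∉ 𝔪_x^{a-μ+1}`. [cite: BierstoneGrigorievMilmanWlodarczyk2011, Lemma 3.2.1] -/
theorem not_colon_le_pow_of_maximalIdeal_eq_span {R : Type*} [CommRing R] [IsLocalRing R]
    [IsDomain R] {u : R} (hu : maximalIdeal R = Ideal.span {u}) (J : Ideal R) {a μ : ℕ}
    (hμa : μ ≤ a) {f : R} (hfJ : f ∈ J) (hfa : f ∈ maximalIdeal R ^ a)
    (hfa1 : f ∉ maximalIdeal R ^ (a + 1)) :
    ¬ Submodule.colon J ((maximalIdeal R ^ μ : Ideal R) : Set R) ≤ maximalIdeal R ^ (a - μ + 1) := by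
  obtain ⟨w, hw, rfl⟩ := exists_eq_pow_mul_unit_of_maximalIdeal_eq_span hu hfa hfa1
  intro hle
  have hmem : u ^ (a - μ) * w ∈ Submodule.colon J ((maximalIdeal R ^ μ : Ideal R) : Set R) := by
    refine Submodule.mem_colon.mpr fun p hp => ?_
    rw [SetLike.mem_coe, hu, Ideal.span_singleton_pow, Ideal.mem_span_singleton] at hp
    obtain ⟨q, rfl⟩ := hp
    have : (u ^ (a - μ) * w) • (u ^ μ * q) = (u ^ a * w) * q := by
      rw [smul_eq_mul, show u ^ a = u ^ (a - μ) * u ^ μ by rw [← pow_add, Nat.sub_add_cancel hμa]]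
      ring
    rw [this]
    exact J.mul_mem_right q hfJ
  have h2 := hle hmem
  rw [hu, Ideal.span_singleton_pow, Ideal.mem_span_singleton] at h2
  obtain ⟨r, hr⟩ := h2
  have h0 : u ^ (a - μ) * (w - u * r) = 0 := by rw [mul_sub, hr, pow_succ]; ring
  rcases mul_eq_zero.mp h0 with h | h
  · obtain ⟨hu0, hne⟩ := pow_eq_zero_iff'.mp h
    apply hfa1
    rw [hu0, zero_pow (by omega), zero_mul]
    exact zero_mem _
  · apply (mem_maximalIdeal _).mp ?_ hw
    rw [sub_eq_zero.mp h, hu]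
    exact Ideal.mul_mem_right r _ (Ideal.mem_span_singleton_self u)

end Transform

/-! ## One point blow-up of a marked ideal -/

section Step

variable [IsLocallyNoetherian X] (M : MarkedIdeal X) {x : X} (hx : IsClosed ({x} : Set X))

/-- The reduced closed point `x ∈ supp(M)` is an admissible centre for `M` when `E` has simple
normal crossings: `{x} ⊆ supp M`, `{x}` has simple normal crossings with `E`, `{x}` is regular.
[cite: BierstoneGrigorievMilmanWlodarczyk2011, Def. 3.1.3 (1)–(2)] -/
theorem isAdmissibleFor_cons_vanishingIdeal_singleton_iff (hsnc : HasSNC M.boundary)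
    (hxM : x ∈ M.support) (rest : CentreSeq (blowup (vanishingIdeal ⟨{x}, hx⟩))) :
    (CentreSeq.cons (vanishingIdeal ⟨{x}, hx⟩) rest).IsAdmissibleFor M ↔
      rest.IsAdmissibleFor
        (M.transform (blowup.π (vanishingIdeal ⟨{x}, hx⟩)) (vanishingIdeal ⟨{x}, hx⟩)) := by
  rw [CentreSeq.isAdmissibleFor_cons]
  refine ⟨fun h => h.2.2.2, fun h => ⟨?_, hsnc.hasSNCWith_vanishingIdeal_singleton hx,
    isRegular_subscheme_vanishingIdeal_singleton hx, h⟩⟩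
  intro y hy
  obtain rfl := (mem_support_vanishingIdeal_singleton_iff hx).mp hy
  exact hxM

variable {M}

omit [IsLocallyNoetherian X] in
/-- At a point of the support of a marked ideal of multiplicity `≥ 1` with non-zero stalk, a
generator `u` of a principal maximal ideal `𝔪_x = (u)` is non-zero. [folklore] -/
private theorem generator_ne_zero_of_mem_support (hμ : 1 ≤ M.mult) (hxM : x ∈ M.support)
    (hJ : stalkIdeal M.ideal x ≠ ⊥) {u : X.presheaf.stalk x}
    (hu : maximalIdeal (X.presheaf.stalk x) = Ideal.span {u}) : u ≠ 0 := by
  rintro rfl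
  apply hJ
  have h := (M.mem_support_iff x).mp hxM
  rw [hu, Ideal.span_singleton_pow, zero_pow (by omega), Ideal.span_singleton_zero] at h
  exact le_bot_iff.mp h

variable (hsnc : HasSNC M.boundary) (hμ : 1 ≤ M.mult) (hxM : x ∈ M.support)
  (hJ : stalkIdeal M.ideal x ≠ ⊥) {u : X.presheaf.stalk x}
  (hu : maximalIdeal (X.presheaf.stalk x) = Ideal.span {u})

include hsnc hμ hxM hJ hu

/-- Under these hypotheses the blowing up of `x` is an isomorphism. [cite: GortzWedhorn2020, (13.19) p. 413] -/
theorem isIso_blowupπ_point : IsIso (blowup.π (vanishingIdeal ⟨{x}, hx⟩)) := by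
  haveI := (hsnc x).1
  haveI := isDomain_of_isRegularLocalRing (X.presheaf.stalk x)
  exact isIso_blowupπ_vanishingIdeal_singleton hx hu (generator_ne_zero_of_mem_support hμ hxM hJ hu)

/-- All stalk maps of the blowing up of `x` are isomorphisms. [cite: GortzWedhorn2020, (13.19) p. 413] -/
theorem isIso_stalkMap_blowupπ_point (y' : blowup (vanishingIdeal ⟨{x}, hx⟩)) :
    IsIso ((blowup.π (vanishingIdeal ⟨{x}, hx⟩)).stalkMap y') := by
  haveI := isIso_blowupπ_point hx hsnc hμ hxM hJ hu
  exact (IsOpenImmersion.iff_isIso_stalkMap.mp inferInstance).2 y'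

/-- **The support of the transform lies over the support**: `supp M' ⊆ π⁻¹ supp M` (the blowing
up being an isomorphism, `ord_{y'} σᶜ(𝓘, μ) ≤ ord_{π y'} 𝓘`). [cite: BierstoneGrigorievMilmanWlodarczyk2011, §3.2] -/
theorem support_transform_point_subset :
    (M.transform (blowup.π (vanishingIdeal ⟨{x}, hx⟩)) (vanishingIdeal ⟨{x}, hx⟩)).support ⊆
      blowup.π (vanishingIdeal ⟨{x}, hx⟩) ⁻¹' M.support := by
  intro y' hy'
  haveI := isIso_stalkMap_blowupπ_point hx hsnc hμ hxM hJ hu y'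
  change (M.mult : ℕ∞) ≤ idealOrder M.ideal _
  have h1 : ((M.transform _ _).mult : ℕ∞) ≤ idealOrder (M.transform _ _).ideal y' := hy'
  rw [MarkedIdeal.transform_mult, MarkedIdeal.transform_ideal] at h1
  exact h1.trans (idealOrder_controlledTransform_le_of_isIso_stalkMap _ _ _ _ y')

/-- Pointwise: `ord_{y'} 𝓘' ≤ ord_{π y'} 𝓘`. [cite: BierstoneGrigorievMilmanWlodarczyk2011, §3.2] -/
theorem idealOrder_transform_point_le (y' : blowup (vanishingIdeal ⟨{x}, hx⟩)) :
    idealOrder (M.transform (blowup.π (vanishingIdeal ⟨{x}, hx⟩)) (vanishingIdeal ⟨{x}, hx⟩)).ideal y' ≤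
      idealOrder M.ideal (blowup.π (vanishingIdeal ⟨{x}, hx⟩) y') := by
  haveI := isIso_stalkMap_blowupπ_point hx hsnc hμ hxM hJ hu y'
  rw [MarkedIdeal.transform_ideal]
  exact idealOrder_controlledTransform_le_of_isIso_stalkMap _ _ _ _ y'

/-- The stalks of the transformed ideal are non-zero over points where the stalks of `𝓘` are.
[cite: BierstoneGrigorievMilmanWlodarczyk2011, §3.2] -/
theorem stalkIdeal_transform_point_ne_bot (y' : blowup (vanishingIdeal ⟨{x}, hx⟩))
    (h : stalkIdeal M.ideal (blowup.π (vanishingIdeal ⟨{x}, hx⟩) y') ≠ ⊥) :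
    stalkIdeal (M.transform (blowup.π (vanishingIdeal ⟨{x}, hx⟩)) (vanishingIdeal ⟨{x}, hx⟩)).ideal y'
      ≠ ⊥ := by
  haveI := isIso_stalkMap_blowupπ_point hx hsnc hμ hxM hJ hu y'
  rw [MarkedIdeal.transform_ideal]
  exact stalkIdeal_controlledTransform_ne_bot_of_isIso_stalkMap _ _ _ _ y' h

/-- Principal maximal ideals upstairs: `𝔪_{y'} = (π^*_{y'} v)` if `𝔪_{π y'} = (v)` (the blowing up
being an isomorphism). [cite: GortzWedhorn2020, (13.19) p. 413] -/
theorem maximalIdeal_eq_span_of_point (y' : blowup (vanishingIdeal ⟨{x}, hx⟩))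
    {v : X.presheaf.stalk (blowup.π (vanishingIdeal ⟨{x}, hx⟩) y')}
    (hv : maximalIdeal _ = Ideal.span {v}) :
    maximalIdeal ((blowup (vanishingIdeal ⟨{x}, hx⟩)).presheaf.stalk y') =
      Ideal.span {((blowup.π (vanishingIdeal ⟨{x}, hx⟩)).stalkMap y').hom v} := by
  haveI := isIso_stalkMap_blowupπ_point hx hsnc hμ hxM hJ hu y'
  have hφ := ConcreteCategory.bijective_of_isIso ((blowup.π (vanishingIdeal ⟨{x}, hx⟩)).stalkMap y')
  rw [← map_maximalIdeal_of_surjective _ hφ.2, hv, Ideal.map_span, Set.image_singleton]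

/-- Closed points upstairs: `{y'}` is closed if `{π y'}` is (the blowing up being an
isomorphism, in particular a homeomorphism onto its image). [cite: GortzWedhorn2020, (13.19) p. 413] -/
theorem isClosed_singleton_of_point (y' : blowup (vanishingIdeal ⟨{x}, hx⟩))
    (h : IsClosed ({blowup.π (vanishingIdeal ⟨{x}, hx⟩) y'} : Set X)) :
    IsClosed ({y'} : Set (blowup (vanishingIdeal ⟨{x}, hx⟩))) := by
  haveI := isIso_blowupπ_point hx hsnc hμ hxM hJ hu
  have hinj : Function.Injective (blowup.π (vanishingIdeal ⟨{x}, hx⟩)) :=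
    (blowup.π (vanishingIdeal ⟨{x}, hx⟩)).isOpenEmbedding.injective
  have : ({y'} : Set _) = blowup.π (vanishingIdeal ⟨{x}, hx⟩) ⁻¹' {blowup.π (vanishingIdeal ⟨{x}, hx⟩) y'} := by
    ext z
    simp only [Set.mem_singleton_iff, Set.mem_preimage]
    exact ⟨fun h => by rw [h], fun h => hinj h⟩
  rw [this]
  exact h.preimage (blowup.π _).continuous

/-- **The order drops at the blown-up point**: at a point `y'` over `x`,
`ord_{y'} σᶜ(𝓘, μ) < ord_x 𝓘` — indeed `σᶜ(𝓘, μ)_{y'} = (𝓘_x : 𝔪_x^μ)` under `𝒪_{X,x} ≅ 𝒪_{X',y'}`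
and `(𝓘_x : 𝔪_x^μ) ∋ u^{a-μ} w ∉ 𝔪_x^{a-μ+1}` for `f = u^a w ∈ 𝓘_x` of order `a = ord_x 𝓘`.
[cite: BierstoneGrigorievMilmanWlodarczyk2011, Lemma 3.2.1; Kollar2007, 3.111 Step 1] -/
theorem idealOrder_transform_point_lt (y' : blowup (vanishingIdeal ⟨{x}, hx⟩))
    (hy' : blowup.π (vanishingIdeal ⟨{x}, hx⟩) y' = x) :
    idealOrder (M.transform (blowup.π (vanishingIdeal ⟨{x}, hx⟩)) (vanishingIdeal ⟨{x}, hx⟩)).ideal y' <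
      idealOrder M.ideal x := by
  -- the hypotheses, restated at the point `π y' = x`
  have hJ' : stalkIdeal M.ideal ((blowup.π (vanishingIdeal ⟨{x}, hx⟩)) y') ≠ ⊥ := by rw [hy']; exact hJ
  have hxM' : (blowup.π (vanishingIdeal ⟨{x}, hx⟩)) y' ∈ M.support := by rw [hy']; exact hxM
  obtain ⟨v, hv⟩ : ∃ v, maximalIdeal (X.presheaf.stalk ((blowup.π (vanishingIdeal ⟨{x}, hx⟩)) y')) = Ideal.span {v} := by
    rw [hy']; exact ⟨u, hu⟩
  have hPx : stalkIdeal (vanishingIdeal ⟨{x}, hx⟩) ((blowup.π (vanishingIdeal ⟨{x}, hx⟩)) y') = maximalIdeal _ := by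
    rw [hy']; exact stalkIdeal_vanishingIdeal_singleton hx
  have hord : idealOrder M.ideal x = idealOrder M.ideal ((blowup.π (vanishingIdeal ⟨{x}, hx⟩)) y') := by rw [hy']
  rw [hord]
  haveI := isIso_stalkMap_blowupπ_point hx hsnc hμ hxM hJ hu y'
  haveI : IsLocallyNoetherian (blowup (vanishingIdeal ⟨{x}, hx⟩)) := CentreSeq.isLocallyNoetherian_blowup _
  haveI := (hsnc ((blowup.π (vanishingIdeal ⟨{x}, hx⟩)) y')).1
  haveI := isDomain_of_isRegularLocalRing (X.presheaf.stalk ((blowup.π (vanishingIdeal ⟨{x}, hx⟩)) y'))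
  -- the order `a` of `𝓘` at `x`
  have hlt : idealOrder M.ideal ((blowup.π (vanishingIdeal ⟨{x}, hx⟩)) y') < ⊤ := idealOrder_lt_top_of_stalkIdeal_ne_bot hJ'
  obtain ⟨a, ha⟩ := ENat.ne_top_iff_exists.mp hlt.ne
  have hJa : stalkIdeal M.ideal ((blowup.π (vanishingIdeal ⟨{x}, hx⟩)) y') ≤ maximalIdeal _ ^ a :=
    (le_idealOrder_iff _ _ a).mp ha.le
  have hJa1 : ¬ stalkIdeal M.ideal ((blowup.π (vanishingIdeal ⟨{x}, hx⟩)) y') ≤ maximalIdeal _ ^ (a + 1) := by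
    intro h
    have := (le_idealOrder_iff _ _ (a + 1)).mpr h
    rw [← ha] at this
    exact absurd (ENat.coe_le_coe.mp this) (by omega)
  obtain ⟨f, hfJ, hfa1⟩ := SetLike.not_le_iff_exists.mp hJa1
  have hfa : f ∈ maximalIdeal _ ^ a := hJa hfJ
  have hμa : M.mult ≤ a := by
    have h := hxM'
    rw [MarkedIdeal.support, Set.mem_setOf_eq, ← ha] at h
    exact ENat.coe_le_coe.mp h
  -- transport to `𝒪_{X', y'}` along the bijective stalk map `φ`
  set φ := ((blowup.π (vanishingIdeal ⟨{x}, hx⟩)).stalkMap y').hom with hφdef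
  have hφ : Function.Bijective φ := ConcreteCategory.bijective_of_isIso ((blowup.π (vanishingIdeal ⟨{x}, hx⟩)).stalkMap y')
  haveI : IsDomain ((blowup (vanishingIdeal ⟨{x}, hx⟩)).presheaf.stalk y') :=
    Function.Injective.isDomain (RingEquiv.ofBijective φ hφ).symm.toRingHom
      (RingEquiv.ofBijective φ hφ).symm.injective
  have hmφ : (maximalIdeal _).map φ = maximalIdeal ((blowup (vanishingIdeal ⟨{x}, hx⟩)).presheaf.stalk y') :=
    map_maximalIdeal_of_surjective φ hφ.2
  have hu' : maximalIdeal ((blowup (vanishingIdeal ⟨{x}, hx⟩)).presheaf.stalk y') = Ideal.span {φ v} :=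
    maximalIdeal_eq_span_of_point hx hsnc hμ hxM hJ hu y' hv
  have hstalk : stalkIdeal (M.transform (blowup.π (vanishingIdeal ⟨{x}, hx⟩)) (vanishingIdeal ⟨{x}, hx⟩)).ideal y' =
      Submodule.colon ((stalkIdeal M.ideal ((blowup.π (vanishingIdeal ⟨{x}, hx⟩)) y')).map φ)
        ((maximalIdeal ((blowup (vanishingIdeal ⟨{x}, hx⟩)).presheaf.stalk y') ^ M.mult : Ideal _) : Set _) := by
    rw [MarkedIdeal.transform_ideal, controlledTransform, stalkIdeal_colon, stalkIdeal_pow,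
      stalkIdeal_comap_eq_map, stalkIdeal_comap_eq_map, hPx, ← hφdef, hmφ]
  have hfa' : φ f ∈ maximalIdeal _ ^ a := by
    rw [← hmφ, ← Ideal.map_pow]
    exact Ideal.mem_map_of_mem _ hfa
  have hfa1' : φ f ∉ maximalIdeal _ ^ (a + 1) := by
    intro h
    rw [← hmφ, ← Ideal.map_pow] at h
    apply hfa1
    have h2 : f ∈ ((maximalIdeal _ ^ (a + 1)).map φ).comap φ := Ideal.mem_comap.mpr h
    rwa [Ideal.comap_map_of_bijective φ hφ] at h2
  have key := not_colon_le_pow_of_maximalIdeal_eq_span hu'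
    ((stalkIdeal M.ideal ((blowup.π (vanishingIdeal ⟨{x}, hx⟩)) y')).map φ) hμa (Ideal.mem_map_of_mem _ hfJ) hfa' hfa1'
  rw [← hstalk] at key
  have hlt' : idealOrder (M.transform (blowup.π (vanishingIdeal ⟨{x}, hx⟩)) (vanishingIdeal ⟨{x}, hx⟩)).ideal y' < ((a - M.mult + 1 : ℕ) : ℕ∞) := by
    by_contra h
    rw [not_lt, le_idealOrder_iff] at h
    exact key h
  rw [← ha]
  exact hlt'.trans_le (ENat.coe_le_coe.mpr (by omega))

end Step

end Literature.AlgebraicGeometry.Resolution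

end
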